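import Summits.AnomalousDissipation.AnomalousDissipation.Theorems.MomentLadder.Negative.Clauses
import Literature.Analysis.FunctionSpaces.TorusEnstrophyTrilinear
import Literature.Analysis.FunctionSpaces.TorusTruncationH1
import Literature.Analysis.FluidPDE.ZerothLaw

/-!
# Tail enstrophy vs. palinstrophy: stub `stub_tailLePalinstrophy` of line `Sketch`
# (crux `MomentParity.MomentLadder`, stmt-AnomalousDissipation-11463)

The spectral gap (A1 of the line): for every integrable field `v` on `T³` and every radius `K`,
`‖∇v‖₂² ≤ ‖∇P_K v‖₂² + ‖Δv‖₂² / (4π²(K²+1))` with all three quantities spectral and `[0, ∞]`-valued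
(`Torus.eGradNormSq`, `Torus.fourierTruncate`, `FluidPDE.eLaplacianNormSq`). Proof: termwise comparison
of the Fourier series `‖∇v‖₂² = 4π² ∑ₖ |k|² |v̂ₖ|²` (`Torus.eGradNormSq_eq_tsum`),
`‖Δv‖₂² = 16π⁴ ∑_{k ≠ 0} |k|⁴ |v̂ₖ|²` (`Torus.eHomSobolevSeminorm_two_sq_eq_tsum'`) and
`𝓕(P_K v) = 𝟙_{|k| ≤ K} v̂` (`Torus.mFourierCoeff_fourierTruncate`): on the ball the modes of `v` and
`P_K v` agree, off the ball `K² + 1 ≤ |k|²` (`Torus.sq_add_one_le_freqNormSq_of_not_mem`, integer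
lattice) gives `4π²|k|² ≤ 16π⁴|k|⁴ / (4π²(K²+1))`.
-/

-- `Summit.<Summit>.<Problem>` is the tree's mandated summit-side namespace (CONVENTIONS §2); for this
-- single-conjunct summit the two coincide, so the duplicate namespace component is deliberate.
set_option linter.dupNamespace false

noncomputable section

namespace Summit.AnomalousDissipation.AnomalousDissipation.Theorems.MomentLadder

open MeasureTheory Filter Topology Set
open scoped ENNReal NNReal InnerProductSpace RealInnerProductSpace Polynomial
open Literature.Analysis.FunctionSpaces Literature.Analysis.FluidPDE
open Summit.AnomalousDissipation.AnomalousDissipation.Theses.MomentParity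
open Summit.AnomalousDissipation.AnomalousDissipation.Theorems.QuarticGate.Negative
open Summit.AnomalousDissipation.AnomalousDissipation.Theorems.MomentLadder.Negative

namespace TailLePalinstrophy

/-- Scalar core of the spectral gap, in `ℝ≥0∞`: if `K² + 1 ≤ q` then
`4π² · q ≤ (4π²(K²+1))⁻¹ · (16π⁴ · q²)`. [folklore] -/
theorem weight_le_inv_mul (K : ℕ) {q : ℝ} (hq : (K : ℝ) ^ 2 + 1 ≤ q) :
    ENNReal.ofReal (4 * Real.pi ^ 2) * ENNReal.ofReal q ≤
      (ENNReal.ofReal (4 * Real.pi ^ 2 * ((K : ℝ) ^ 2 + 1)))⁻¹ *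
        (ENNReal.ofReal (16 * Real.pi ^ 4) * ENNReal.ofReal (q ^ (2 : ℝ))) := by
  have hm : 0 < 4 * Real.pi ^ 2 * ((K : ℝ) ^ 2 + 1) := by positivity
  rw [← ENNReal.mul_le_iff_le_inv (ENNReal.ofReal_pos.2 hm).ne' ENNReal.ofReal_ne_top,
    ← ENNReal.ofReal_mul (by positivity), ← ENNReal.ofReal_mul (by positivity),
    ← ENNReal.ofReal_mul (by positivity), Real.rpow_two]
  refine ENNReal.ofReal_le_ofReal ?_
  have hq0 : 0 ≤ q := le_trans (by positivity) hq
  have h16 : 0 ≤ 16 * Real.pi ^ 4 * q := by positivity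
  calc 4 * Real.pi ^ 2 * ((K : ℝ) ^ 2 + 1) * (4 * Real.pi ^ 2 * q)
      = 16 * Real.pi ^ 4 * q * ((K : ℝ) ^ 2 + 1) := by ring
    _ ≤ 16 * Real.pi ^ 4 * q * q := mul_le_mul_of_nonneg_left hq h16
    _ = 16 * Real.pi ^ 4 * q ^ 2 := by ring

/-- Termwise form of the spectral gap: for every frequency `k`, the `k`-th term of `‖∇v‖₂²` is at most
the `k`-th term of `‖∇P_K v‖₂²` plus `(4π²(K²+1))⁻¹` times the `k`-th term of `‖Δv‖₂²` (equality of
the modes on the ball `|k| ≤ K`; `K² + 1 ≤ |k|²` and `k ≠ 0` off it). [folklore] -/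
theorem term_le (K : ℕ) {v : UnitAddTorus (Fin 3) → EuclideanSpace ℝ (Fin 3)}
    (hv : Integrable v volume) (k : Fin 3 → ℤ) :
    ENNReal.ofReal (4 * Real.pi ^ 2) * (ENNReal.ofReal (Torus.freqNormSq k) *
        ‖UnitAddTorus.mFourierCoeff (EuclideanSpace.complexify ∘ v) k‖ₑ ^ 2) ≤
      ENNReal.ofReal (4 * Real.pi ^ 2) * (ENNReal.ofReal (Torus.freqNormSq k) *
          ‖UnitAddTorus.mFourierCoeff (EuclideanSpace.complexify ∘ Torus.fourierTruncate K v) k‖ₑ ^ 2) +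
        (ENNReal.ofReal (4 * Real.pi ^ 2 * ((K : ℝ) ^ 2 + 1)))⁻¹ *
          (ENNReal.ofReal (16 * Real.pi ^ 4) *
            ((if k = 0 then 0 else ENNReal.ofReal (Torus.freqNormSq k ^ (2 : ℝ))) *
              ‖UnitAddTorus.mFourierCoeff (EuclideanSpace.complexify ∘ v) k‖ₑ ^ 2)) := by
  rw [Torus.mFourierCoeff_fourierTruncate hv]
  by_cases hk : k ∈ Torus.freqBall K
  · rw [if_pos hk]
    exact le_self_add
  · have hk0 : k ≠ 0 := fun h => hk (h ▸ Torus.zero_mem_freqBall K)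
    rw [if_neg hk, if_neg hk0, enorm_zero, zero_pow two_ne_zero, mul_zero, mul_zero, zero_add]
    calc ENNReal.ofReal (4 * Real.pi ^ 2) * (ENNReal.ofReal (Torus.freqNormSq k) *
          ‖UnitAddTorus.mFourierCoeff (EuclideanSpace.complexify ∘ v) k‖ₑ ^ 2)
        = ENNReal.ofReal (4 * Real.pi ^ 2) * ENNReal.ofReal (Torus.freqNormSq k) *
          ‖UnitAddTorus.mFourierCoeff (EuclideanSpace.complexify ∘ v) k‖ₑ ^ 2 := (mul_assoc _ _ _).symm
      _ ≤ (ENNReal.ofReal (4 * Real.pi ^ 2 * ((K : ℝ) ^ 2 + 1)))⁻¹ *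
            (ENNReal.ofReal (16 * Real.pi ^ 4) * ENNReal.ofReal (Torus.freqNormSq k ^ (2 : ℝ))) *
          ‖UnitAddTorus.mFourierCoeff (EuclideanSpace.complexify ∘ v) k‖ₑ ^ 2 :=
        mul_le_mul_left (weight_le_inv_mul K (Torus.sq_add_one_le_freqNormSq_of_not_mem hk)) _
      _ = _ := by simp only [mul_assoc]

end TailLePalinstrophy

/-- **A1, the spectral gap between enstrophy and palinstrophy beyond the Galerkin ball**: for every
integrable field `v` on `T³` and every `K`,
`‖∇v‖₂² ≤ ‖∇P_K v‖₂² + (4π²(K²+1))⁻¹ ‖Δv‖₂²` (spectral quantities in `[0, ∞]`): termwise comparison of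
the Fourier series (`TailLePalinstrophy.term_le`). [folklore] -/
theorem stub_tailLePalinstrophy :
    ∀ (K : ℕ) (v : UnitAddTorus (Fin 3) → EuclideanSpace ℝ (Fin 3)), Integrable v volume →
      Torus.eGradNormSq v ≤ Torus.eGradNormSq (Torus.fourierTruncate K v) +
        (ENNReal.ofReal (4 * Real.pi ^ 2 * ((K : ℝ) ^ 2 + 1)))⁻¹ * eLaplacianNormSq v := by
  intro K v hv
  rw [Torus.eGradNormSq_eq_tsum, Torus.eGradNormSq_eq_tsum, eLaplacianNormSq,
    Torus.eHomSobolevSeminorm_two_sq_eq_tsum']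
  calc ENNReal.ofReal (4 * Real.pi ^ 2) * ∑' k : Fin 3 → ℤ, ENNReal.ofReal (Torus.freqNormSq k) *
          ‖UnitAddTorus.mFourierCoeff (EuclideanSpace.complexify ∘ v) k‖ₑ ^ 2
      = ∑' k : Fin 3 → ℤ, ENNReal.ofReal (4 * Real.pi ^ 2) * (ENNReal.ofReal (Torus.freqNormSq k) *
          ‖UnitAddTorus.mFourierCoeff (EuclideanSpace.complexify ∘ v) k‖ₑ ^ 2) := ENNReal.tsum_mul_left.symm
    _ ≤ ∑' k : Fin 3 → ℤ, (ENNReal.ofReal (4 * Real.pi ^ 2) * (ENNReal.ofReal (Torus.freqNormSq k) *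
          ‖UnitAddTorus.mFourierCoeff (EuclideanSpace.complexify ∘ Torus.fourierTruncate K v) k‖ₑ ^ 2) +
          (ENNReal.ofReal (4 * Real.pi ^ 2 * ((K : ℝ) ^ 2 + 1)))⁻¹ *
            (ENNReal.ofReal (16 * Real.pi ^ 4) *
              ((if k = 0 then 0 else ENNReal.ofReal (Torus.freqNormSq k ^ (2 : ℝ))) *
                ‖UnitAddTorus.mFourierCoeff (EuclideanSpace.complexify ∘ v) k‖ₑ ^ 2))) :=
        ENNReal.tsum_le_tsum fun k => TailLePalinstrophy.term_le K hv k
    _ = _ := by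
        rw [ENNReal.tsum_add, ENNReal.tsum_mul_left, ENNReal.tsum_mul_left, ENNReal.tsum_mul_left]

end Summit.AnomalousDissipation.AnomalousDissipation.Theorems.MomentLadder

end
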